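import Summits.KontsevichZagierPeriods.KontsevichZagierPeriods.Theorems.K2SymbolChainsJensenIsScissorsToolkit

/-!
# Jensen is scissors — toolkit IV: lifting a change of variables of the base

Support file for item stmt-KontsevichZagierPeriods-5204 (`JensenIsScissors`, route
KontsevichZagierPeriods/K2SymbolChains). Kontsevich–Zagier rule-2) data `(Ψ, Ψ')` on a base
`σ ⊆ ℝᵐ` lift to the map `z ↦ (Ψ (init z), z last)` of `ℝᵐ⁺¹`, which is rule-2) data on every
`ℚ`-semialgebraic `D` lying over `σ`, with the same Jacobian determinant (`det` of a block-diagonal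
map; pattern `KZ.of_sub_of_mem_relations_covLift` of `KZLogCalculusProofs.lean`, which treats
one-sided bands and concludes in `KZ.relations`). The image of a fibred set
`{(b, u) | b ∈ σ, P b u}` is `{(b', u) | b' ∈ Ψ σ, P' b' u}` whenever `P b u ↔ P' (Ψ b) u`; in
particular the signed unfolding domain of `log (V' ∘ Ψ)` over `σ` goes to that of `log V'` over
`Ψ σ`. Consequences: `[r] − [r'] ∈ S` for matching representations, and existence of the image
representation. [Kontsevich–Zagier 2001, §1.2, rule 2)] [folklore]
-/

noncomputable section

open MeasureTheory Set
open Literature.NumberTheory.Transcendental Literature.ModelTheory.ExponentialFields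

namespace Summit.KontsevichZagierPeriods.K2SymbolChains.JensenIsScissorsProof

open Literature.NumberTheory.Transcendental.KZ

variable {m : ℕ} {S : AddSubgroup FormalRep}

/-- The lifted derivative `w ↦ (L (init w), w last)` applied. [folklore] -/
theorem baseLiftDeriv_apply (L : (Fin m → ℝ) →L[ℝ] (Fin m → ℝ)) (w : Fin (m + 1) → ℝ) :
    (ContinuousLinearMap.pi (Fin.lastCases (motive := fun _ => (Fin (m + 1) → ℝ) →L[ℝ] ℝ)
      (ContinuousLinearMap.proj (Fin.last m))
      (fun i => (ContinuousLinearMap.proj i).comp (L.comp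
        (ContinuousLinearMap.pi fun j => ContinuousLinearMap.proj (Fin.castSucc j))))) :
        (Fin (m + 1) → ℝ) →L[ℝ] (Fin (m + 1) → ℝ)) w = Fin.snoc (L (Fin.init w)) (w (Fin.last m)) := by
  funext i
  refine Fin.lastCases ?_ (fun j => ?_) i
  · simp
  · simp
    rfl

/-- **Determinant of the lifted derivative**: `det (w ↦ (L (init w), w last)) = det L`.
[folklore] -/
theorem det_baseLiftDeriv (L : (Fin m → ℝ) →L[ℝ] (Fin m → ℝ)) :
    (ContinuousLinearMap.pi (Fin.lastCases (motive := fun _ => (Fin (m + 1) → ℝ) →L[ℝ] ℝ)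
      (ContinuousLinearMap.proj (Fin.last m))
      (fun i => (ContinuousLinearMap.proj i).comp (L.comp
        (ContinuousLinearMap.pi fun j => ContinuousLinearMap.proj (Fin.castSucc j))))) :
        (Fin (m + 1) → ℝ) →L[ℝ] (Fin (m + 1) → ℝ)).det = L.det := by
  have h := LinearMap.det_of_snoc_init
    ((ContinuousLinearMap.pi (Fin.lastCases (motive := fun _ => (Fin (m + 1) → ℝ) →L[ℝ] ℝ)
      (ContinuousLinearMap.proj (Fin.last m))
      (fun i => (ContinuousLinearMap.proj i).comp (L.comp
        (ContinuousLinearMap.pi fun j => ContinuousLinearMap.proj (Fin.castSucc j))))) :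
        (Fin (m + 1) → ℝ) →L[ℝ] (Fin (m + 1) → ℝ)) : (Fin (m + 1) → ℝ) →ₗ[ℝ] (Fin (m + 1) → ℝ))
    (L : (Fin m → ℝ) →ₗ[ℝ] (Fin m → ℝ)) 0 1 (fun w => by
      rw [ContinuousLinearMap.coe_coe, baseLiftDeriv_apply]
      simp)
  rw [one_mul] at h
  exact h

/-- **Lifting rule-2) data of the base.** For rule-2) data `(Ψ, Ψ')` on a base `σ ⊆ ℝᵐ` and a
`ℚ`-semialgebraic `D ⊆ ℝᵐ⁺¹` over `σ`, the lift `z ↦ (Ψ (init z), z last)` is a `ℚ`-semialgebraic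
injective map on `D` with derivative `w ↦ (Ψ' (init z) (init w), w last)` within `D`.
[Kontsevich–Zagier 2001, §1.2, rule 2)] [folklore] -/
theorem baseLift_covData {σ : Set (Fin m → ℝ)} {Ψ : (Fin m → ℝ) → (Fin m → ℝ)}
    {Ψ' : (Fin m → ℝ) → (Fin m → ℝ) →L[ℝ] (Fin m → ℝ)} (hΨ : IsSemialgebraicMapOn ℚ σ Ψ)
    (hΨ' : ∀ b ∈ σ, HasFDerivWithinAt Ψ (Ψ' b) σ b) (hinj : InjOn Ψ σ)
    {D : Set (Fin (m + 1) → ℝ)} (hD : IsSemialgebraic ℚ D) (hDσ : D ⊆ {z | Fin.init z ∈ σ}) :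
    IsSemialgebraicMapOn ℚ D (fun z => (Fin.snoc (Ψ (Fin.init z)) (z (Fin.last m)) : Fin (m + 1) → ℝ)) ∧
      (∀ z ∈ D, HasFDerivWithinAt
          (fun z => (Fin.snoc (Ψ (Fin.init z)) (z (Fin.last m)) : Fin (m + 1) → ℝ))
          (ContinuousLinearMap.pi (Fin.lastCases (motive := fun _ => (Fin (m + 1) → ℝ) →L[ℝ] ℝ)
            (ContinuousLinearMap.proj (Fin.last m))
            (fun i => (ContinuousLinearMap.proj i).comp ((Ψ' (Fin.init z)).comp
              (ContinuousLinearMap.pi fun j => ContinuousLinearMap.proj (Fin.castSucc j))))))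
          D z) ∧
      InjOn (fun z => (Fin.snoc (Ψ (Fin.init z)) (z (Fin.last m)) : Fin (m + 1) → ℝ)) D := by
  have hσ : IsSemialgebraic ℚ σ := IsSemialgebraicMapOn.isSemialgebraic_holds hΨ
  have hmem : ∀ z ∈ D, Fin.init z ∈ σ := fun z hz => hDσ hz
  let initL : (Fin (m + 1) → ℝ) →L[ℝ] (Fin m → ℝ) :=
    ContinuousLinearMap.pi fun j => ContinuousLinearMap.proj (Fin.castSucc j)
  have hinitL : ∀ w, initL w = Fin.init w := fun w => rfl
  refine ⟨?_, ?_, ?_⟩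
  · refine (isSemialgebraicMapOn_iff_forall_holds hD).mpr fun i => ?_
    refine Fin.lastCases ?_ (fun j => ?_) i
    · exact (isSemialgebraicFunOn_apply hD (Fin.last _)).congr fun z _ => by simp
    · have hj : IsSemialgebraicFunOn ℚ σ (fun x => Ψ x j) :=
        (isSemialgebraicMapOn_iff_forall_holds hσ).mp hΨ j
      exact (hj.comp_init.mono hmem hD).congr fun z _ => by simp
  · intro z hz
    have hx := hmem z hz
    -- derivative of `init` within `D`, landing in `σ`
    have h1 : HasFDerivWithinAt (fun w : Fin (m + 1) → ℝ => Fin.init w) initL D z :=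
      initL.hasFDerivAt.hasFDerivWithinAt
    have hmaps : MapsTo (fun w : Fin (m + 1) → ℝ => Fin.init w) D σ := fun w hw => hmem w hw
    have hΨc : HasFDerivWithinAt (fun w : Fin (m + 1) → ℝ => Ψ (Fin.init w))
        ((Ψ' (Fin.init z)).comp initL) D z :=
      (hΨ' _ hx).comp z h1 hmaps
    rw [hasFDerivWithinAt_pi']
    intro i
    refine Fin.lastCases ?_ (fun j => ?_) i
    · have hfun : (fun w : Fin (m + 1) → ℝ =>
          (Fin.snoc (Ψ (Fin.init w)) (w (Fin.last m)) : Fin (m + 1) → ℝ) (Fin.last m)) =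
          fun w => w (Fin.last m) := by
        funext w; simp
      rw [hfun]
      refine ((hasFDerivAt_apply (Fin.last m) z).hasFDerivWithinAt).congr_fderiv
        (ContinuousLinearMap.ext fun w => ?_)
      simp
    · have hfun : (fun w : Fin (m + 1) → ℝ =>
          (Fin.snoc (Ψ (Fin.init w)) (w (Fin.last m)) : Fin (m + 1) → ℝ) (Fin.castSucc j)) =
          fun w => Ψ (Fin.init w) j := by
        funext w; simp
      rw [hfun]
      have h2 : HasFDerivWithinAt (fun w : Fin (m + 1) → ℝ => Ψ (Fin.init w) j)
          ((ContinuousLinearMap.proj j).comp ((Ψ' (Fin.init z)).comp initL)) D z :=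
        (ContinuousLinearMap.proj (R := ℝ) (φ := fun _ : Fin m => ℝ) j).hasFDerivAt.comp_hasFDerivWithinAt z hΨc
      refine h2.congr_fderiv (ContinuousLinearMap.ext fun w => ?_)
      simp [initL]
  · intro z₁ hz₁ z₂ hz₂ h
    have h1 : Ψ (Fin.init z₁) = Ψ (Fin.init z₂) := by simpa using congrArg Fin.init h
    have h2 : z₁ (Fin.last m) = z₂ (Fin.last m) := by simpa using congrFun h (Fin.last m)
    rw [← Fin.snoc_init_self z₁, ← Fin.snoc_init_self z₂, hinj (hmem _ hz₁) (hmem _ hz₂) h1, h2]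

/-- **Image of a fibred set under the lift.** If `D` lies over `σ`, `D'` lies over `Ψ '' σ`, and
membership of `(b, u)` in `D` is equivalent to membership of `(Ψ b, u)` in `D'` for `b ∈ σ`, then the
lift maps `D` onto `D'`. [folklore] -/
theorem image_baseLift {σ : Set (Fin m → ℝ)} {Ψ : (Fin m → ℝ) → (Fin m → ℝ)}
    {D D' : Set (Fin (m + 1) → ℝ)} (hDσ : D ⊆ {z | Fin.init z ∈ σ})
    (hD'σ : D' ⊆ {z | Fin.init z ∈ Ψ '' σ})
    (hiff : ∀ b ∈ σ, ∀ u : ℝ, (Fin.snoc b u : Fin (m + 1) → ℝ) ∈ D ↔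
      (Fin.snoc (Ψ b) u : Fin (m + 1) → ℝ) ∈ D') :
    (fun z => (Fin.snoc (Ψ (Fin.init z)) (z (Fin.last m)) : Fin (m + 1) → ℝ)) '' D = D' := by
  ext w
  simp only [mem_image]
  constructor
  · rintro ⟨z, hz, rfl⟩
    have hb : Fin.init z ∈ σ := hDσ hz
    have := (hiff _ hb (z (Fin.last m))).1 (by rw [Fin.snoc_init_self]; exact hz)
    exact this
  · intro hw
    obtain ⟨b, hb, hbw⟩ : Fin.init w ∈ Ψ '' σ := hD'σ hw
    refine ⟨Fin.snoc b (w (Fin.last m)), ?_, ?_⟩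
    · rw [hiff b hb]
      rw [hbw, Fin.snoc_init_self]
      exact hw
    · simp [hbw]

/-- The signed unfolding domain of `log (V' ∘ Ψ)` over `σ` is carried by the lift onto the signed
unfolding domain of `log V'` over `Ψ '' σ`. [Kontsevich–Zagier 2001, §1.1] [folklore] -/
theorem image_baseLift_logUnfoldDomain {σ : Set (Fin m → ℝ)} {Ψ : (Fin m → ℝ) → (Fin m → ℝ)}
    {V V' : (Fin m → ℝ) → ℝ} (hVV' : ∀ b ∈ σ, V b = V' (Ψ b)) :
    (fun z => (Fin.snoc (Ψ (Fin.init z)) (z (Fin.last m)) : Fin (m + 1) → ℝ)) ''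
      logUnfoldDomain σ V = logUnfoldDomain (Ψ '' σ) V' := by
  refine image_baseLift (fun z hz => hz.1) (fun z hz => hz.1) fun b hb u => ?_
  simp only [snoc_mem_logUnfoldDomain, hVV' b hb]
  exact ⟨fun h => ⟨mem_image_of_mem Ψ hb, h.2⟩, fun h => ⟨hb, h.2⟩⟩

/-- **Base change of variables inside `S`.** For rule-2) data `(Ψ, Ψ')` on `σ`, a representation `r`
on a `ℚ`-semialgebraic `D` over `σ` and a representation `r'` on the image `D'` of `D` under the lift
(membership transported as in `image_baseLift`), with
`r.integrand z = r'.integrand (Ψ (init z), z last) · |det Ψ' (init z)|` on `D`: `[r] − [r'] ∈ S`.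
[Kontsevich–Zagier 2001, §1.2, rule 2)] [folklore] -/
theorem of_sub_of_mem_baseLift (hS : domainAddRel ∪ integrandAddRel ∪ changeOfVariablesRel ⊆ S)
    {σ : Set (Fin m → ℝ)} {Ψ : (Fin m → ℝ) → (Fin m → ℝ)}
    {Ψ' : (Fin m → ℝ) → (Fin m → ℝ) →L[ℝ] (Fin m → ℝ)} (hΨ : IsSemialgebraicMapOn ℚ σ Ψ)
    (hΨ' : ∀ b ∈ σ, HasFDerivWithinAt Ψ (Ψ' b) σ b) (hinj : InjOn Ψ σ)
    (r r' : IntegralRep (m + 1)) (hDσ : r.domain ⊆ {z | Fin.init z ∈ σ})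
    (hD'σ : r'.domain ⊆ {z | Fin.init z ∈ Ψ '' σ})
    (hiff : ∀ b ∈ σ, ∀ u : ℝ, (Fin.snoc b u : Fin (m + 1) → ℝ) ∈ r.domain ↔
      (Fin.snoc (Ψ b) u : Fin (m + 1) → ℝ) ∈ r'.domain)
    (hint : ∀ z ∈ r.domain, r.integrand z =
      r'.integrand (Fin.snoc (Ψ (Fin.init z)) (z (Fin.last m))) * |(Ψ' (Fin.init z)).det|) :
    of r - of r' ∈ S := by
  obtain ⟨h1, h2, h3⟩ := baseLift_covData hΨ hΨ' hinj r.isSemialgebraic_domain hDσ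
  refine mem_of_mem_changeOfVariablesRel hS ⟨m + 1, r, r', _, _, h1, h2, h3, ?_, fun z hz => ?_, rfl⟩
  · exact (image_baseLift hDσ hD'σ hiff).symm
  · rw [hint z hz, det_baseLiftDeriv]

/-- **The image of a representation under a lifted base change exists** (and differs from it by an
element of `S`): given `r` on `D` over `σ`, a target set `D'` over `Ψ '' σ` with transported
membership, `ℚ`-semialgebraic, and a `ℚ`-semialgebraic `f'` on `D'` with
`r.integrand z = f' (Ψ (init z), z last) · |det Ψ' (init z)|` on `D`.
[Kontsevich–Zagier 2001, §1.2, rule 2)] [folklore] -/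
theorem exists_image_baseLift (hS : domainAddRel ∪ integrandAddRel ∪ changeOfVariablesRel ⊆ S)
    {σ : Set (Fin m → ℝ)} {Ψ : (Fin m → ℝ) → (Fin m → ℝ)}
    {Ψ' : (Fin m → ℝ) → (Fin m → ℝ) →L[ℝ] (Fin m → ℝ)} (hΨ : IsSemialgebraicMapOn ℚ σ Ψ)
    (hΨ' : ∀ b ∈ σ, HasFDerivWithinAt Ψ (Ψ' b) σ b) (hinj : InjOn Ψ σ)
    (r : IntegralRep (m + 1)) (hDσ : r.domain ⊆ {z | Fin.init z ∈ σ})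
    {D' : Set (Fin (m + 1) → ℝ)} (hD'σ : D' ⊆ {z | Fin.init z ∈ Ψ '' σ})
    (hiff : ∀ b ∈ σ, ∀ u : ℝ, (Fin.snoc b u : Fin (m + 1) → ℝ) ∈ r.domain ↔
      (Fin.snoc (Ψ b) u : Fin (m + 1) → ℝ) ∈ D')
    {f' : (Fin (m + 1) → ℝ) → ℝ} (hf' : IsSemialgebraicFunOn ℚ D' f')
    (hint : ∀ z ∈ r.domain, r.integrand z =
      f' (Fin.snoc (Ψ (Fin.init z)) (z (Fin.last m))) * |(Ψ' (Fin.init z)).det|) :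
    ∃ r' : IntegralRep (m + 1), r'.domain = D' ∧ r'.integrand = f' ∧ of r - of r' ∈ S := by
  obtain ⟨h1, h2, h3⟩ := baseLift_covData hΨ hΨ' hinj r.isSemialgebraic_domain hDσ
  have himg := image_baseLift hDσ hD'σ hiff
  rw [← himg] at hf'
  obtain ⟨r', hd, hi, hrel⟩ := exists_image_rep r h1 h2 h3 hf' (fun z hz => by
    rw [hint z hz, det_baseLiftDeriv])
  exact ⟨r', hd.trans himg, hi, mem_of_mem_changeOfVariablesRel hS hrel⟩

end Summit.KontsevichZagierPeriods.K2SymbolChains.JensenIsScissorsProof
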